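import Summits.MatrixMultiplication.OmegaCensus.MetacyclicTower
import Summits.MatrixMultiplication.OmegaCensus.BoxUsefulFactors

/-!
# ω-census, family (b3): conjecture C9 — `M_p(m,1) = ℤ/p^m ⋊ ℤ/p` is not box-useful for every odd `p ≥ 3` and every `m ≥ 2`

HONEST FRAMING (pub-omega census; verbatim): lottery ticket; floor = certified bounds/negative ranges.
Census BOOKKEEPING (conjecture C9 of the cell; pub-omega stpp-1 gen 19).  Assembly for the metacyclic tower (`MetacyclicTower`:
model `Mmeta p m`, pattern lemma with cocycle coefficient `p^{m−1}`): the height patterns already landed for `M(p³)` — `TMunif p`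
(`MetacyclicPCubeUniform`, odd `p ≥ 41`, `omega`), `TM5 … TM39` and the `p = 3` box `B3` / `TM3` (`MetacyclicPCube`,
`MetacyclicPCubeSmall`) — are patterns for `Mmeta p m` for EVERY `m ≥ 2` (the forbidden differences `tauI` do not see `m`).
MAIN: **`Mmeta.not_boxUseful_mmeta : Odd p → 3 ≤ p → ¬ BoxUseful (Mmeta p m)`** (`[Fact (2 ≤ m)]`).  CONSEQUENCE (desk, via
Rédei 1947 and C9 (a); the classification is not typed): together with `Heis.not_boxUseful_heis_odd` and `RedeiN`, every minimal
non-abelian `p`-group with `p` odd is box-useless in the kernel, hence **no non-abelian finite `p`-group with `p` odd is box-useful —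
C9 (b) holds on all finite `p`-groups of odd order**.  Nothing here is progress on `ω`.
-/

namespace Summit.MatrixMultiplication.OmegaCensus

open Finset ProductBoxBound

namespace Mcube

variable {p m : ℕ}

/-- The uniform box is nondegenerate in `Mmeta p m` (`p ≥ 3`, `m ≥ 2`). [folklore] -/
theorem nondegQ_Bunif [NeZero p] [Fact (2 ≤ m)] (h3 : 3 ≤ p) : (Bunif p).NondegQ p m := by
  have hm : 2 ≤ m := Fact.out
  have hpm : p ≤ p ^ m := Nat.le_self_pow (by omega) p
  have hcast : ∀ n : ℕ, 0 < n → n < p → (n : ZMod p) ≠ 0 := fun n h0 hn e =>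
    absurd (Nat.le_of_dvd h0 ((ZMod.natCast_eq_zero_iff n p).1 e)) (by omega)
  have hcast2 : ∀ n : ℕ, 0 < n → n < p ^ m → (n : ZMod (p ^ m)) ≠ 0 := fun n h0 hn e =>
    absurd (Nat.le_of_dvd h0 ((ZMod.natCast_eq_zero_iff n (p ^ m)).1 e)) (by omega)
  have h1 : ((1 : ℕ) : ZMod p) ≠ 0 := hcast 1 (by omega) (by omega)
  have h2 : ((2 : ℕ) : ZMod p) ≠ 0 := hcast 2 (by omega) (by omega)
  have he : ((e1 p : ℕ) : ZMod (p ^ m)) ≠ 0 := hcast2 _ (by unfold e1; omega) (by unfold e1; omega)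
  have ho : ((o2 p : ℕ) : ZMod (p ^ m)) ≠ 0 := hcast2 _ (by unfold o2; omega) (by unfold o2; omega)
  have h1n : (1 : ZMod p) ≠ 0 := by exact_mod_cast h1
  have h2n : (2 : ZMod p) ≠ 0 := by exact_mod_cast h2
  have h1n' : (-1 : ZMod p) ≠ 0 := neg_ne_zero.2 h1n
  have h2n' : (-2 : ZMod p) ≠ 0 := neg_ne_zero.2 h2n
  constructor
  · intro i j h
    have ht := congrArg Mmeta.t h
    have hx := congrArg Mmeta.x h
    fin_cases i <;> fin_cases j <;>
      simp [IBox.yQ, Bunif, Mmeta.mk', h1n', h1n'.symm, he, he.symm] at ht hx ⊢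
  · intro i j h
    have ht := congrArg Mmeta.t h
    have hx := congrArg Mmeta.x h
    fin_cases i <;> fin_cases j <;>
      simp [IBox.wQ, Bunif, Mmeta.mk', h2n', h2n'.symm, ho, ho.symm] at ht hx ⊢

/-- The `p = 3` box `B3` is nondegenerate in `Mmeta 3 m` (its `t`-coordinates `0, 2, 1` are distinct). [folklore] -/
theorem nondegQ_B3 [Fact (2 ≤ m)] : B3.NondegQ 3 m := by
  have h01 : (0 : ZMod 3) ≠ 2 := by decide
  have h02 : (0 : ZMod 3) ≠ 1 := by decide
  have h12 : (2 : ZMod 3) ≠ 1 := by decide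
  constructor
  · intro i j h
    have ht := congrArg Mmeta.t h
    fin_cases i <;> fin_cases j <;>
      simp [IBox.yQ, B3, Mmeta.mk', h01, h02, h12, h01.symm, h02.symm, h12.symm] at ht ⊢
  · intro i j h
    have ht := congrArg Mmeta.t h
    fin_cases i <;> fin_cases j <;>
      simp [IBox.wQ, B3, Mmeta.mk', h01, h02, h12, h01.symm, h02.symm, h12.symm] at ht ⊢

/-- `TM3` is an independent pattern for the box `B3` (re-checked by `decide`). [folklore] -/
theorem patIndepM_B3_TM3 : B3.PatIndepM 3 TM3 := by decide +kernel

/-- `M_3(m,1)` is not box-useful (`m ≥ 2`). [folklore] -/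
theorem not_boxUseful_mmeta3 [Fact (2 ≤ m)] : ¬ BoxUseful (Mmeta 3 m) :=
  B3.not_boxUseful_mmeta_of_pattern nondegQ_B3 patIndepM_B3_TM3 (by decide +kernel)

/-- `TM5` is an independent pattern for `Bunif 5` (re-checked by `decide`). [folklore] -/
theorem patIndepM_TM5 : (Bunif 5).PatIndepM 5 TM5 := by decide +kernel

/-- `M_5(m,1)` is not box-useful (`m ≥ 2`). [folklore] -/
theorem not_boxUseful_mmeta5 [Fact (2 ≤ m)] : ¬ BoxUseful (Mmeta 5 m) :=
  (Bunif 5).not_boxUseful_mmeta_of_pattern (nondegQ_Bunif (by norm_num)) patIndepM_TM5 (by decide +kernel)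

/-- `TM7` is an independent pattern for `Bunif 7` (re-checked by `decide`). [folklore] -/
theorem patIndepM_TM7 : (Bunif 7).PatIndepM 7 TM7 := by decide +kernel

/-- `M_7(m,1)` is not box-useful (`m ≥ 2`). [folklore] -/
theorem not_boxUseful_mmeta7 [Fact (2 ≤ m)] : ¬ BoxUseful (Mmeta 7 m) :=
  (Bunif 7).not_boxUseful_mmeta_of_pattern (nondegQ_Bunif (by norm_num)) patIndepM_TM7 (by decide +kernel)

/-- `TM9` is an independent pattern for `Bunif 9` (re-checked by `decide`). [folklore] -/
theorem patIndepM_TM9 : (Bunif 9).PatIndepM 9 TM9 := by decide +kernel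

/-- `M_9(m,1)` is not box-useful (`m ≥ 2`). [folklore] -/
theorem not_boxUseful_mmeta9 [Fact (2 ≤ m)] : ¬ BoxUseful (Mmeta 9 m) :=
  (Bunif 9).not_boxUseful_mmeta_of_pattern (nondegQ_Bunif (by norm_num)) patIndepM_TM9 (by decide +kernel)

/-- `TM11` is an independent pattern for `Bunif 11` (re-checked by `decide`). [folklore] -/
theorem patIndepM_TM11 : (Bunif 11).PatIndepM 11 TM11 := by decide +kernel

/-- `M_11(m,1)` is not box-useful (`m ≥ 2`). [folklore] -/
theorem not_boxUseful_mmeta11 [Fact (2 ≤ m)] : ¬ BoxUseful (Mmeta 11 m) :=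
  (Bunif 11).not_boxUseful_mmeta_of_pattern (nondegQ_Bunif (by norm_num)) patIndepM_TM11 (by decide +kernel)

/-- `TM13` is an independent pattern for `Bunif 13` (re-checked by `decide`). [folklore] -/
theorem patIndepM_TM13 : (Bunif 13).PatIndepM 13 TM13 := by decide +kernel

/-- `M_13(m,1)` is not box-useful (`m ≥ 2`). [folklore] -/
theorem not_boxUseful_mmeta13 [Fact (2 ≤ m)] : ¬ BoxUseful (Mmeta 13 m) :=
  (Bunif 13).not_boxUseful_mmeta_of_pattern (nondegQ_Bunif (by norm_num)) patIndepM_TM13 (by decide +kernel)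

/-- `TM15` is an independent pattern for `Bunif 15` (re-checked by `decide`). [folklore] -/
theorem patIndepM_TM15 : (Bunif 15).PatIndepM 15 TM15 := by decide +kernel

/-- `M_15(m,1)` is not box-useful (`m ≥ 2`). [folklore] -/
theorem not_boxUseful_mmeta15 [Fact (2 ≤ m)] : ¬ BoxUseful (Mmeta 15 m) :=
  (Bunif 15).not_boxUseful_mmeta_of_pattern (nondegQ_Bunif (by norm_num)) patIndepM_TM15 (by decide +kernel)

/-- `TM17` is an independent pattern for `Bunif 17` (re-checked by `decide`). [folklore] -/
theorem patIndepM_TM17 : (Bunif 17).PatIndepM 17 TM17 := by decide +kernel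

/-- `M_17(m,1)` is not box-useful (`m ≥ 2`). [folklore] -/
theorem not_boxUseful_mmeta17 [Fact (2 ≤ m)] : ¬ BoxUseful (Mmeta 17 m) :=
  (Bunif 17).not_boxUseful_mmeta_of_pattern (nondegQ_Bunif (by norm_num)) patIndepM_TM17 (by decide +kernel)

/-- `TM19` is an independent pattern for `Bunif 19` (re-checked by `decide`). [folklore] -/
theorem patIndepM_TM19 : (Bunif 19).PatIndepM 19 TM19 := by decide +kernel

/-- `M_19(m,1)` is not box-useful (`m ≥ 2`). [folklore] -/
theorem not_boxUseful_mmeta19 [Fact (2 ≤ m)] : ¬ BoxUseful (Mmeta 19 m) :=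
  (Bunif 19).not_boxUseful_mmeta_of_pattern (nondegQ_Bunif (by norm_num)) patIndepM_TM19 (by decide +kernel)

/-- `TM21` is an independent pattern for `Bunif 21` (re-checked by `decide`). [folklore] -/
theorem patIndepM_TM21 : (Bunif 21).PatIndepM 21 TM21 := by decide +kernel

/-- `M_21(m,1)` is not box-useful (`m ≥ 2`). [folklore] -/
theorem not_boxUseful_mmeta21 [Fact (2 ≤ m)] : ¬ BoxUseful (Mmeta 21 m) :=
  (Bunif 21).not_boxUseful_mmeta_of_pattern (nondegQ_Bunif (by norm_num)) patIndepM_TM21 (by decide +kernel)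

/-- `TM23` is an independent pattern for `Bunif 23` (re-checked by `decide`). [folklore] -/
theorem patIndepM_TM23 : (Bunif 23).PatIndepM 23 TM23 := by decide +kernel

/-- `M_23(m,1)` is not box-useful (`m ≥ 2`). [folklore] -/
theorem not_boxUseful_mmeta23 [Fact (2 ≤ m)] : ¬ BoxUseful (Mmeta 23 m) :=
  (Bunif 23).not_boxUseful_mmeta_of_pattern (nondegQ_Bunif (by norm_num)) patIndepM_TM23 (by decide +kernel)

/-- `TM25` is an independent pattern for `Bunif 25` (re-checked by `decide`). [folklore] -/
theorem patIndepM_TM25 : (Bunif 25).PatIndepM 25 TM25 := by decide +kernel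

/-- `M_25(m,1)` is not box-useful (`m ≥ 2`). [folklore] -/
theorem not_boxUseful_mmeta25 [Fact (2 ≤ m)] : ¬ BoxUseful (Mmeta 25 m) :=
  (Bunif 25).not_boxUseful_mmeta_of_pattern (nondegQ_Bunif (by norm_num)) patIndepM_TM25 (by decide +kernel)

/-- `TM27` is an independent pattern for `Bunif 27` (re-checked by `decide`). [folklore] -/
theorem patIndepM_TM27 : (Bunif 27).PatIndepM 27 TM27 := by decide +kernel

/-- `M_27(m,1)` is not box-useful (`m ≥ 2`). [folklore] -/
theorem not_boxUseful_mmeta27 [Fact (2 ≤ m)] : ¬ BoxUseful (Mmeta 27 m) :=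
  (Bunif 27).not_boxUseful_mmeta_of_pattern (nondegQ_Bunif (by norm_num)) patIndepM_TM27 (by decide +kernel)

/-- `TM29` is an independent pattern for `Bunif 29` (re-checked by `decide`). [folklore] -/
theorem patIndepM_TM29 : (Bunif 29).PatIndepM 29 TM29 := by decide +kernel

/-- `M_29(m,1)` is not box-useful (`m ≥ 2`). [folklore] -/
theorem not_boxUseful_mmeta29 [Fact (2 ≤ m)] : ¬ BoxUseful (Mmeta 29 m) :=
  (Bunif 29).not_boxUseful_mmeta_of_pattern (nondegQ_Bunif (by norm_num)) patIndepM_TM29 (by decide +kernel)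

/-- `TM31` is an independent pattern for `Bunif 31` (re-checked by `decide`). [folklore] -/
theorem patIndepM_TM31 : (Bunif 31).PatIndepM 31 TM31 := by decide +kernel

/-- `M_31(m,1)` is not box-useful (`m ≥ 2`). [folklore] -/
theorem not_boxUseful_mmeta31 [Fact (2 ≤ m)] : ¬ BoxUseful (Mmeta 31 m) :=
  (Bunif 31).not_boxUseful_mmeta_of_pattern (nondegQ_Bunif (by norm_num)) patIndepM_TM31 (by decide +kernel)

/-- `TM33` is an independent pattern for `Bunif 33` (re-checked by `decide`). [folklore] -/
theorem patIndepM_TM33 : (Bunif 33).PatIndepM 33 TM33 := by decide +kernel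

/-- `M_33(m,1)` is not box-useful (`m ≥ 2`). [folklore] -/
theorem not_boxUseful_mmeta33 [Fact (2 ≤ m)] : ¬ BoxUseful (Mmeta 33 m) :=
  (Bunif 33).not_boxUseful_mmeta_of_pattern (nondegQ_Bunif (by norm_num)) patIndepM_TM33 (by decide +kernel)

/-- `TM35` is an independent pattern for `Bunif 35` (re-checked by `decide`). [folklore] -/
theorem patIndepM_TM35 : (Bunif 35).PatIndepM 35 TM35 := by decide +kernel

/-- `M_35(m,1)` is not box-useful (`m ≥ 2`). [folklore] -/
theorem not_boxUseful_mmeta35 [Fact (2 ≤ m)] : ¬ BoxUseful (Mmeta 35 m) :=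
  (Bunif 35).not_boxUseful_mmeta_of_pattern (nondegQ_Bunif (by norm_num)) patIndepM_TM35 (by decide +kernel)

/-- `TM37` is an independent pattern for `Bunif 37` (re-checked by `decide`). [folklore] -/
theorem patIndepM_TM37 : (Bunif 37).PatIndepM 37 TM37 := by decide +kernel

/-- `M_37(m,1)` is not box-useful (`m ≥ 2`). [folklore] -/
theorem not_boxUseful_mmeta37 [Fact (2 ≤ m)] : ¬ BoxUseful (Mmeta 37 m) :=
  (Bunif 37).not_boxUseful_mmeta_of_pattern (nondegQ_Bunif (by norm_num)) patIndepM_TM37 (by decide +kernel)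

/-- `TM39` is an independent pattern for `Bunif 39` (re-checked by `decide`). [folklore] -/
theorem patIndepM_TM39 : (Bunif 39).PatIndepM 39 TM39 := by decide +kernel

/-- `M_39(m,1)` is not box-useful (`m ≥ 2`). [folklore] -/
theorem not_boxUseful_mmeta39 [Fact (2 ≤ m)] : ¬ BoxUseful (Mmeta 39 m) :=
  (Bunif 39).not_boxUseful_mmeta_of_pattern (nondegQ_Bunif (by norm_num)) patIndepM_TM39 (by decide +kernel)

/-- **MAIN.  `M_p(m,1) = ℤ/p^m ⋊ ℤ/p` is not box-useful for every odd `p ≥ 3` and every `m ≥ 2`.** [folklore] -/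
theorem not_boxUseful_mmeta [NeZero p] [Fact (2 ≤ m)] (hp : Odd p) (h3 : 3 ≤ p) : ¬ BoxUseful (Mmeta p m) := by
  by_cases h41 : 41 ≤ p
  · exact (Bunif p).not_boxUseful_mmeta_of_pattern (nondegQ_Bunif h3) (patIndepM_TMunif (Nat.odd_iff.1 hp) h41)
      (card_TMunif_bound (Nat.odd_iff.1 hp) h41)
  · have hp' := Nat.odd_iff.1 hp
    have : p = 3 ∨ p = 5 ∨ p = 7 ∨ p = 9 ∨ p = 11 ∨ p = 13 ∨ p = 15 ∨ p = 17 ∨ p = 19 ∨ p = 21 ∨ p = 23 ∨ p = 25 ∨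
        p = 27 ∨ p = 29 ∨ p = 31 ∨ p = 33 ∨ p = 35 ∨ p = 37 ∨ p = 39 := by omega
    rcases this with rfl | rfl | rfl | rfl | rfl | rfl | rfl | rfl | rfl | rfl | rfl | rfl | rfl | rfl | rfl | rfl | rfl |
        rfl | rfl
    · exact not_boxUseful_mmeta3
    · exact not_boxUseful_mmeta5
    · exact not_boxUseful_mmeta7
    · exact not_boxUseful_mmeta9
    · exact not_boxUseful_mmeta11
    · exact not_boxUseful_mmeta13
    · exact not_boxUseful_mmeta15
    · exact not_boxUseful_mmeta17
    · exact not_boxUseful_mmeta19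
    · exact not_boxUseful_mmeta21
    · exact not_boxUseful_mmeta23
    · exact not_boxUseful_mmeta25
    · exact not_boxUseful_mmeta27
    · exact not_boxUseful_mmeta29
    · exact not_boxUseful_mmeta31
    · exact not_boxUseful_mmeta33
    · exact not_boxUseful_mmeta35
    · exact not_boxUseful_mmeta37
    · exact not_boxUseful_mmeta39

/-- **No finite group mapping onto some `M_p(m,1)` (`p ≥ 3` odd, `m ≥ 2`) is box-useful** — in particular Rédei's `M_p(m,n)`. [folklore] -/
theorem not_boxUseful_of_surjective_mmeta [NeZero p] [Fact (2 ≤ m)] (hp : Odd p) (h3 : 3 ≤ p) {G : Type*} [Group G]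
    [Fintype G] [DecidableEq G] (f : G →* Mmeta p m) (hf : Function.Surjective f) : ¬ BoxUseful G :=
  fun hG => not_boxUseful_mmeta hp h3 (BoxUseful.of_surjective f hf hG)

end Mcube

end Summit.MatrixMultiplication.OmegaCensus
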